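import Mathlib
import HarnessLib
import Literature.Analysis.FluidPDE.ClassicalSolution
import Literature.Analysis.FluidPDE.LerayHopf
import Literature.Analysis.FluidPDE.SelfSimilar
import Literature.Analysis.FluidPDE.SelfSimilarLiouville
import Literature.Analysis.FluidPDE.LocalTypeI
import Literature.Analysis.FluidPDE.VectorCalculus
import Literature.Analysis.FluidPDE.TypeIAncientMild
import Literature.Analysis.FluidPDE.ChaeWolfRemovingDSS
import Literature.Analysis.FluidPDE.ChaeWolfRemovingDSSProofs
import Literature.Analysis.FluidPDE.ChaeWolfRemovingDSSLimit
import Literature.Analysis.UnboundedOperators.HeatKernel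
import Summits.NavierStokesRegularity.NavierStokesRegularity.Theorems.LocalVelCompTubeDoorLocalPointZoomVelSlices
import Summits.NavierStokesRegularity.NavierStokesRegularity.Theorems.PlaneStrainDoorZoomSpaceTimeDecay
import Summits.NavierStokesRegularity.NavierStokesRegularity.Theorems.LocalSineTubeDoorProfileAlignedWindowRigidityAncient
import Summits.NavierStokesRegularity.NavierStokesRegularity.Theorems.PoloidalWindowDoorPoloidalWindowRigidityStrata
import Summits.NavierStokesRegularity.NavierStokesRegularity.Theorems.PoloidalWindowDoorPoloidalWindowRigidityFlat
import Summits.NavierStokesRegularity.NavierStokesRegularity.Theorems.PoloidalWindowDoorPoloidalWindowRigidityWindow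
import Summits.NavierStokesRegularity.NavierStokesRegularity.Theorems.TypeIDSSLiouvilleConjecture
import Summits.NavierStokesRegularity.NavierStokesRegularity.Theorems.AdaptedFrequencyTangentFlowTransferAncientPressure
import Summits.NavierStokesRegularity.NavierStokesRegularity.Theorems.PeepholeEchoDoorDefs

/-!
# ZoomReturnDoorDefs — S25 «ZoomReturnDoor» (small echoes near ratio one; removable DSS factors), part 1/4

§0 the observables (S23's `twoTimeDefect` / `HasTwoPointSymmetry` are IMPORTED from `PeepholeEchoDoorDefs`; new here:
`DefectEventuallySmall`, `profileDefect`, `HasSmallEchoOn`, the door class `IsDoorProfile`) and ALL the texts of S25: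
K1-small `LocalPointZoomSmallEcho`, R-small `SmallEchoResidueAt`, doors T5⁺ `TargetSmallEchoAt`/`TargetSmallEcho`,
the λ-axis package `RemovableFactor` / `removableSet` / K-open `RemovableSetOpen` / `BandResidue` / K-band `BandStability`,
the general band door `TargetSmallEchoBandAt`, and door T6 `TargetRestlessAt`/`TargetRestless`.  Definitions only.

Door family of LADDER-NS N0 (local Type-I window doors S20–S25); THEOREMS-ONLY landing of the nsreg-p1 design
`run/shared/lean/pub/ns-regularity-ideate/ns-regularity-ideate-p1/r24/Sketch25.lean` (ROUND-24.md).  Door T5⁺ «no SMALL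
near-one echo»: a space–time local Type-I point whose two-time defect at a ratio in a near-one band is EVENTUALLY `ε`-small on
a window (`ε` fixed before the ratio) is regular; corollary door T6 «restless profile».  Everything conditional is conditional on
the two CLAIMED compactness theorems K-band `BandStability` / K-open `RemovableSetOpen` (Chae–Wolf 2017 §3 engine, tree
`Literature.Analysis.FluidPDE.ChaeWolf.exists_limit`, run with a convergent factor sequence), which enter as hypotheses.
No route, no items (DIRECTOR-NS standing #32 (2)).  WHAT THIS IS NOT: not a regularity claim; not an attack on
`TypeIDSSLiouville`; the band door is EXACTLY as strong as the graded DSS wall on its band (`removable_of_bandResidue`).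
-/

noncomputable section

set_option linter.dupNamespace false

namespace Summit.NavierStokesRegularity.NavierStokesRegularity.Theorems.ZoomReturnDoorDefs

open MeasureTheory Set Function Filter Topology TopologicalSpace Metric
open scoped RealInnerProductSpace NNReal ENNReal Topology Pointwise
open Literature.Analysis Literature.Analysis.FluidPDE
open Summit.NavierStokesRegularity.NavierStokesRegularity.Theorems.LocalSineTubeDoorProfileAlignedWindowRigidityAncient
open Summit.NavierStokesRegularity.NavierStokesRegularity.Theorems.PoloidalWindowDoorPoloidalWindowRigidityStrata
open Summit.NavierStokesRegularity.NavierStokesRegularity.Theorems.PoloidalWindowDoorPoloidalWindowRigidityFlat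
open Summit.NavierStokesRegularity.NavierStokesRegularity.Theorems.PoloidalWindowDoorPoloidalWindowRigidityWindow
open Summit.NavierStokesRegularity.NavierStokesRegularity.Theorems.PeepholeEchoDoorDefs

/-- **The defect is EVENTUALLY `ε`-SMALL on the window `U`** (no fading asked): for `t` close to `T⁻`,
`∫_U (two-time defect)(t, y) dy ≤ ε`. -/
def DefectEventuallySmall (T : ℝ) (x₀ : EuclideanSpace ℝ (Fin 3))
    (u : ℝ → EuclideanSpace ℝ (Fin 3) → EuclideanSpace ℝ (Fin 3)) (κ μ : ℝ) (U : Set (EuclideanSpace ℝ (Fin 3)))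
    (ε : ℝ) : Prop :=
  ∀ᶠ t in nhdsWithin T (Set.Iio T), ∫⁻ y in U, ENNReal.ofReal (twoTimeDefect T x₀ u κ μ t y) ≤ ENNReal.ofReal ε

/-- The profile-side defect in window coordinates: at profile time `s < 0` the window sits at similarity scale
`σ = √(−s)/√ν`; the defect compares `(σν)·v(s, σy)` with `(μσν)·v(κs, μσy)`. -/
def profileDefect (ν : ℝ) (v : ℝ → EuclideanSpace ℝ (Fin 3) → EuclideanSpace ℝ (Fin 3)) (κ μ s : ℝ)
    (y : EuclideanSpace ℝ (Fin 3)) : ℝ :=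
  ‖(Real.sqrt (-s) / Real.sqrt ν * ν) • v s ((Real.sqrt (-s) / Real.sqrt ν) • y) -
    (μ * (Real.sqrt (-s) / Real.sqrt ν) * ν) • v (κ * s) ((μ * (Real.sqrt (-s) / Real.sqrt ν)) • y)‖

/-- **`ε`-small echo of the profile on the window `U` at EVERY profile time.** -/
def HasSmallEchoOn (ν κ μ ε : ℝ) (U : Set (EuclideanSpace ℝ (Fin 3)))
    (v : ℝ → EuclideanSpace ℝ (Fin 3) → EuclideanSpace ℝ (Fin 3)) : Prop :=
  ∀ s < 0, ∫⁻ y in U, ENNReal.ofReal (profileDefect ν v κ μ s y) ≤ ENNReal.ofReal ε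

/-- The DOOR CLASS of profiles: Type-I time rate `C`, continuous on the open slab, unit-viscosity Oseen–Duhamel between
any two negative times, divergence-free slices (the conjuncts every S-door residue carries). -/
def IsDoorProfile (C : ℝ) (v : ℝ → EuclideanSpace ℝ (Fin 3) → EuclideanSpace ℝ (Fin 3)) : Prop :=
  Literature.Analysis.FluidPDE.HasTypeITimeDecay C v ∧
    ContinuousOn (Function.uncurry v) (Set.Iio (0 : ℝ) ×ˢ Set.univ) ∧
    (∀ s t : ℝ, s < t → t < 0 → ∀ x, v t x =
      Literature.Analysis.UnboundedOperators.heatExtension (v s) (t - s) x -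
        Literature.Analysis.FluidPDE.oseenDuhamel 1 s v v t x) ∧
    ∀ t < 0, Literature.Analysis.FluidPDE.VectorCalculus.IsDivFree (v t)

/-- crux (rank 3) · K1-small · THE SMALL-ECHO ZOOM (PROVED, `localPointZoomSmallEcho_holds`): space–time local Type I
at `(x₀, T)` + backward unboundedness ⇒ ONE door-class profile with decay `M/ν`, backward-singular at the apex, on
which every EVENTUALLY `ε`-SMALL two-time defect through ANY set `U` leaves an `ε`-small echo at every profile time. -/
def LocalPointZoomSmallEcho : Prop :=
  ∀ (ν T : ℝ), 0 < ν → 0 < T → ∀ (u : ℝ → EuclideanSpace ℝ (Fin 3) → EuclideanSpace ℝ (Fin 3))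
    (p : ℝ → EuclideanSpace ℝ (Fin 3) → ℝ), Literature.Analysis.FluidPDE.IsClassicalNSSolutionOn (Set.Ico 0 T) ν 0 u p →
    Literature.Analysis.FluidPDE.IsLerayHopfOn T ν 0 (u 0) u → Literature.Analysis.FluidPDE.HasRapidSpatialDecay (u 0) →
    ∀ (x₀ : EuclideanSpace ℝ (Fin 3)) (ρ M : ℝ), 0 < ρ →
    (∀ t ∈ Set.Ico 0 T, T - ρ ^ 2 < t → ∀ x ∈ Metric.ball x₀ ρ, ‖u t x‖ * (‖x - x₀‖ + Real.sqrt (ν * (T - t))) ≤ M) →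
    ¬ Literature.Analysis.FluidPDE.IsBackwardBoundedAt u T x₀ →
    ∃ (C : ℝ) (v : ℝ → EuclideanSpace ℝ (Fin 3) → EuclideanSpace ℝ (Fin 3)), IsDoorProfile C v ∧
      Literature.Analysis.FluidPDE.HasTypeIDecay (M / ν) v ∧ Literature.Analysis.FluidPDE.IsBackwardSingularPoint v 0 ∧
      ∀ (κ μ ε : ℝ), 0 < κ → ∀ (U : Set (EuclideanSpace ℝ (Fin 3))),
        DefectEventuallySmall T x₀ u κ μ U ε → HasSmallEchoOn ν κ μ ε U v

/-- crux (rank 2) · R-small · THE SMALL-ECHO RESIDUE near ratio one (PROVED below from K-band `BandStability`: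
`smallEchoResidueAt_of_bandStability`, §6; K-band itself is the claimed compactness theorem): for viscosity `ν` and decay constant
`D` there is `κ₁ < 1` such that for every band `[a,b] ⊂ (κ₁,1)` and every bounded open nonempty window `U` some
`ε > 0` forbids backward-singular door-class profiles with decay `D` and an `ε`-small echo on `U` at a ratio in the band. -/
def SmallEchoResidueAt (ν D : ℝ) : Prop :=
  ∃ κ₁ : ℝ, 0 < κ₁ ∧ κ₁ < 1 ∧ ∀ (a b : ℝ), κ₁ < a → b < 1 →
    ∀ (U : Set (EuclideanSpace ℝ (Fin 3))), IsOpen U → U.Nonempty → Bornology.IsBounded U →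
    ∃ ε : ℝ, 0 < ε ∧ ∀ κ ∈ Set.Icc a b, ∀ (C : ℝ) (v : ℝ → EuclideanSpace ℝ (Fin 3) → EuclideanSpace ℝ (Fin 3)),
      IsDoorProfile C v → Literature.Analysis.FluidPDE.HasTypeIDecay D v → HasSmallEchoOn ν κ (Real.sqrt κ) ε U v →
      ¬ Literature.Analysis.FluidPDE.IsBackwardSingularPoint v 0

/-- target (rank 0) · DOOR T5⁺ «no SMALL near-one echo» at constants `ν, M`: there is `κ₁ < 1` such that for every
band `[a,b] ⊂ (κ₁,1)` and bounded open nonempty window `U` some `ε > 0` makes «space–time local Type I with constant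
`M` at `(x₀,T)` + two-time defect at a ratio `κ ∈ [a,b]` eventually `ε`-small on `U`» impossible at a singular point. -/
def TargetSmallEchoAt (ν M : ℝ) : Prop :=
  ∃ κ₁ : ℝ, 0 < κ₁ ∧ κ₁ < 1 ∧ ∀ (a b : ℝ), κ₁ < a → b < 1 →
    ∀ (U : Set (EuclideanSpace ℝ (Fin 3))), IsOpen U → U.Nonempty → Bornology.IsBounded U →
    ∃ ε : ℝ, 0 < ε ∧ ∀ κ ∈ Set.Icc a b, ∀ (T : ℝ), 0 < T →
      ∀ (u : ℝ → EuclideanSpace ℝ (Fin 3) → EuclideanSpace ℝ (Fin 3)) (p : ℝ → EuclideanSpace ℝ (Fin 3) → ℝ),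
      Literature.Analysis.FluidPDE.IsClassicalNSSolutionOn (Set.Ico 0 T) ν 0 u p →
      Literature.Analysis.FluidPDE.IsLerayHopfOn T ν 0 (u 0) u → Literature.Analysis.FluidPDE.HasRapidSpatialDecay (u 0) →
      ∀ (x₀ : EuclideanSpace ℝ (Fin 3)) (ρ : ℝ), 0 < ρ →
      (∀ t ∈ Set.Ico 0 T, T - ρ ^ 2 < t → ∀ x ∈ Metric.ball x₀ ρ, ‖u t x‖ * (‖x - x₀‖ + Real.sqrt (ν * (T - t))) ≤ M) →
      DefectEventuallySmall T x₀ u κ (Real.sqrt κ) U ε → Literature.Analysis.FluidPDE.IsBackwardBoundedAt u T x₀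

/-- target (rank 0) · DOOR T5⁺ for all constants. -/
def TargetSmallEcho : Prop :=
  ∀ (ν M : ℝ), 0 < ν → TargetSmallEchoAt ν M

/-- assembly (rank 1) of Part A at constants `ν, M`. -/
def AssemblyA (ν M : ℝ) : Prop :=
  LocalPointZoomSmallEcho → SmallEchoResidueAt ν (M / ν) → TargetSmallEchoAt ν M

/-- A factor `c` is REMOVABLE at decay `D`: every classical `c`-DSS solution of Navier–Stokes (`ν = 1`) on
`(−∞,0) × ℝ³` with the Type-I bound `‖u(t,x)‖ ≤ D/(‖x‖+√(−t))` vanishes (the matrix of `chaeWolf2017_removing_dss`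
at one `c`, one `D`). -/
def RemovableFactor (D c : ℝ) : Prop :=
  ∀ (u : ℝ → EuclideanSpace ℝ (Fin 3) → EuclideanSpace ℝ (Fin 3)) (p : ℝ → EuclideanSpace ℝ (Fin 3) → ℝ),
    Literature.Analysis.FluidPDE.IsClassicalNSSolutionOn (Set.Iio 0) 1 0 u p →
    Literature.Analysis.FluidPDE.IsDiscretelySelfSimilar c u → Literature.Analysis.FluidPDE.HasTypeIDecay D u →
    ∀ t < 0, ∀ x, u t x = 0

/-- The REMOVABLE SET at decay `D`: the factors `c > 1` removable at decay `D`. -/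
def removableSet (D : ℝ) : Set ℝ := {c | 1 < c ∧ RemovableFactor D c}

/-- crux (rank 2) · K-open · OPENNESS OF THE REMOVABLE SET (CLAIMED THEOREM): for every decay constant `D > 0` the
set of removable factors is open in `(1, ∞)`. -/
def RemovableSetOpen : Prop := ∀ D : ℝ, 0 < D → IsOpen (removableSet D)

/-- An `ε`-STABLE BAND `[a,b]` of ratios at viscosity `ν` and decay `D`: for every bounded open nonempty window `U`
some `ε > 0` makes every classical Type-I (`D`) solution on `(−∞,0) × ℝ³` with an `ε`-small echo on `U` at a ratio
`κ ∈ [a,b]` (rescaling `√κ`) vanish. -/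
def BandResidue (ν D a b : ℝ) : Prop :=
  ∀ (U : Set (EuclideanSpace ℝ (Fin 3))), IsOpen U → U.Nonempty → Bornology.IsBounded U →
    ∃ ε : ℝ, 0 < ε ∧ ∀ κ ∈ Set.Icc a b,
      ∀ (u : ℝ → EuclideanSpace ℝ (Fin 3) → EuclideanSpace ℝ (Fin 3)) (p : ℝ → EuclideanSpace ℝ (Fin 3) → ℝ),
      Literature.Analysis.FluidPDE.IsClassicalNSSolutionOn (Set.Iio 0) 1 0 u p →
      Literature.Analysis.FluidPDE.HasTypeIDecay D u → HasSmallEchoOn ν κ (Real.sqrt κ) ε U u →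
      ∀ t < 0, ∀ x, u t x = 0

/-- crux (rank 2) · K-band · `ε`-STABILITY OF REMOVABLE BANDS (CLAIMED THEOREM): if every factor `1/√κ`, `κ ∈ [a,b]
⊂ (0,1)`, is removable at decay `D`, the band is `ε`-stable at every viscosity. -/
def BandStability : Prop :=
  ∀ (ν D a b : ℝ), 0 < ν → 0 < D → 0 < a → b < 1 →
    (∀ κ ∈ Set.Icc a b, RemovableFactor D (Real.sqrt κ)⁻¹) → BandResidue ν D a b

/-- target (rank 0′) · THE GENERAL BAND DOOR T5-band at constants `ν, M` and band `[a,b]`: for every bounded open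
nonempty window `U` some `ε > 0` makes «space–time local Type I with constant `M` + two-time defect at a ratio
`κ ∈ [a,b]` eventually `ε`-small on `U`» impossible at a singular point. -/
def TargetSmallEchoBandAt (ν M a b : ℝ) : Prop :=
  ∀ (U : Set (EuclideanSpace ℝ (Fin 3))), IsOpen U → U.Nonempty → Bornology.IsBounded U →
    ∃ ε : ℝ, 0 < ε ∧ ∀ κ ∈ Set.Icc a b, ∀ (T : ℝ), 0 < T →
      ∀ (u : ℝ → EuclideanSpace ℝ (Fin 3) → EuclideanSpace ℝ (Fin 3)) (p : ℝ → EuclideanSpace ℝ (Fin 3) → ℝ),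
      Literature.Analysis.FluidPDE.IsClassicalNSSolutionOn (Set.Ico 0 T) ν 0 u p →
      Literature.Analysis.FluidPDE.IsLerayHopfOn T ν 0 (u 0) u → Literature.Analysis.FluidPDE.HasRapidSpatialDecay (u 0) →
      ∀ (x₀ : EuclideanSpace ℝ (Fin 3)) (ρ : ℝ), 0 < ρ →
      (∀ t ∈ Set.Ico 0 T, T - ρ ^ 2 < t → ∀ x ∈ Metric.ball x₀ ρ, ‖u t x‖ * (‖x - x₀‖ + Real.sqrt (ν * (T - t))) ≤ M) →
      DefectEventuallySmall T x₀ u κ (Real.sqrt κ) U ε → Literature.Analysis.FluidPDE.IsBackwardBoundedAt u T x₀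

/-- target (rank 0″) · DOOR T6 «restless profile» at constants `ν, M`. -/
def TargetRestlessAt (ν M : ℝ) : Prop :=
  ∀ (U : Set (EuclideanSpace ℝ (Fin 3))), IsOpen U → U.Nonempty → Bornology.IsBounded U → ∀ (h₀ : ℝ), 0 < h₀ →
    ∃ ε : ℝ, 0 < ε ∧ ∀ (T : ℝ), 0 < T →
      ∀ (u : ℝ → EuclideanSpace ℝ (Fin 3) → EuclideanSpace ℝ (Fin 3)) (p : ℝ → EuclideanSpace ℝ (Fin 3) → ℝ),
      Literature.Analysis.FluidPDE.IsClassicalNSSolutionOn (Set.Ico 0 T) ν 0 u p →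
      Literature.Analysis.FluidPDE.IsLerayHopfOn T ν 0 (u 0) u → Literature.Analysis.FluidPDE.HasRapidSpatialDecay (u 0) →
      ∀ (x₀ : EuclideanSpace ℝ (Fin 3)) (ρ : ℝ), 0 < ρ →
      (∀ t ∈ Set.Ico 0 T, T - ρ ^ 2 < t → ∀ x ∈ Metric.ball x₀ ρ, ‖u t x‖ * (‖x - x₀‖ + Real.sqrt (ν * (T - t))) ≤ M) →
      (∀ᶠ t in nhdsWithin T (Set.Iio T), ∀ κ : ℝ, Real.exp (-h₀) ≤ κ → κ < 1 →
          ∫⁻ y in U, ENNReal.ofReal (twoTimeDefect T x₀ u κ (Real.sqrt κ) t y) ≤ ENNReal.ofReal (ε * Real.log κ⁻¹)) →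
      Literature.Analysis.FluidPDE.IsBackwardBoundedAt u T x₀

/-- door T6 for all constants. -/
def TargetRestless : Prop :=
  ∀ (ν M : ℝ), 0 < ν → TargetRestlessAt ν M

end Summit.NavierStokesRegularity.NavierStokesRegularity.Theorems.ZoomReturnDoorDefs
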